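import Literature.NumberTheory.ComplexMultiplication.EllipticUnits.ImaginaryQuadraticMainConjectureClassGroupRowLayers
import Literature.NumberTheory.GaloisCohomology.ShaRestrictedLayerLocalLimit
import HarnessLib

/-!
# The local data of plug (π3) of ROW 1 over the `ℤ_p²`-tower: coboundaries from the strict / unramified conditions over `K̃_∞`,
# their transfer to the layer coefficients `(ℤ/p^k)(θ)`, and the local vanishing (resp. `2`-torsion) of the layer classes at
# `Gal(K̄_v/K̃_{∞,w})` (Johnson-Leung–Kings 2011 Lemma 5.8, the `Ш¹`-side of the class-group row)

Topic `Literature/NumberTheory/ComplexMultiplication/EllipticUnits` (grouping sub-namespace `JohnsonLeungKings2011.ClassGroupRow`).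
Cell `bsd-print-cf2`, width seat `bsd-line-cf2c-w8` g8.  THEOREMS ONLY (no definition, no named fact, no instance, no `sorry`).
`H = pairKer κ₁ κ₂ = Gal(K̄/K̃_∞)`, `V_n = pairLayerSubgroup κ₁ κ₂ n`, `M = charModule ∅ θ = (F/𝓞)(θ)`, `S = supp(p𝔣)`,
layer coefficients `(ℤ/p^k)(θ) = zmodTwist p (unitChar θ) k` compared through `e = zmodToCharModule θ k`.

* §1 `exists_coboundary_of_mem_strictKer` / `exists_coboundary_of_mem_unramifiedKer` — for a cocycle `c` of `V_n` whose restriction to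
  `H` represents `s`, the STRICT condition of `conj_τ s` at `v` (resp. the UNRAMIFIED condition) is a coboundary identity
  `τ·c(τ⁻¹xτ) = x a − a` on `H ⊓ D_v` (resp. `H ⊓ I_v`) with `a ∈ M`;
* §2 `layer_coboundary_of_coboundary` — transfer of that identity to the descended layer cocycle `z` (`e ∘ z ∘ π = c`) and `a = e a′`;
* §3 `two_nsmul_resLe_loc_conj_eq_zero_of_strict` / `…_of_unramified` — hence `2 •` (resp. exactly) the restriction to
  `Λ_H = res_v⁻¹H ≤ Γ_{K_v}` of the localisation at `v` of `conj_{πτ}[z]` vanishes (`ShaRestrictedLayerLocalLimit`), the ramified case using an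
  inertia element on which `unitChar θ = −1`.

What is NOT here: the colimit/finiteness assembly producing a layer class in `Ш¹_S` (plug (π3) final step).  HONEST FRAMING: no BSD, no main
conjecture; no summit statement is proved by this seat.

## References
* J. Johnson-Leung, G. Kings (2011), §5.4 Lemma 5.8 (arXiv p0015:L150–165). [JohnsonLeungKings2011]
* J. S. Milne, *Arithmetic Duality Theorems* (2006), I §4 (p. 56). [MilneADT2006]
* R. Greenberg, *Iwasawa theory for p-adic representations* (1989), §1 p. 98 (strict condition). [Greenberg1989]
-/

noncomputable section

open scoped NumberField
open CategoryTheory Field IsDedekindDomain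
open Literature.NumberTheory.GaloisRepresentations
open Literature.NumberTheory.GaloisRepresentations.DiscreteGaloisModule
open Literature.NumberTheory.GaloisCohomology Literature.NumberTheory.GaloisCohomology.ShaLayer
open Literature.NumberTheory.EllipticCurves Literature.NumberTheory.EllipticCurves.KellerYin2024
open Literature.NumberTheory.EllipticCurves.GreenbergSelmer Literature.NumberTheory.EllipticCurves.GreenbergVatsal2000

namespace Literature.NumberTheory.ComplexMultiplication.EllipticUnits.JohnsonLeungKings2011.ClassGroupRow

variable {K : Type} [Field K] [NumberField K] (p : ℕ) [Fact p.Prime]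
  (κ₁ κ₂ : ZpExtension K p) (θ : FramedGaloisRep K (padicCoeffIntegers (∅ : Set (PadicAlgCl p))) 1) (𝔣 : Ideal (𝓞 K))

/-! ## §1 Coboundaries from the strict / unramified conditions over `K̃_∞` -/

omit [NumberField K] in
/-- The conjugated cocycle `x ↦ τ • f(τ⁻¹ x τ)` of a cocycle `f` of `H = Gal(K̄/K̃_∞)`, in terms of a cocycle `c` of `V_n` restricting
to `f`: its value at `x` is `τ • c(τ⁻¹ x τ)`. [cite: SerreLocalFields1979, VII §5 Prop. 3] -/
theorem conj_pullback_pairKer_apply (n : ℕ) (c : contOneCocycles (discreteTopRep (↥(pairLayerSubgroup κ₁ κ₂ n))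
      (charModule (∅ : Set (PadicAlgCl p)) θ))) (τ : absoluteGaloisGroup K)
    (hc : ∀ (x : ↥(ZpExtension.pairKer κ₁ κ₂)) (m : charModule (∅ : Set (PadicAlgCl p)) θ),
      DistribSMul.toAddMonoidHom _ τ (subgroupConj (ZpExtension.pairKer κ₁ κ₂) τ x • m) = x • DistribSMul.toAddMonoidHom _ τ m)
    (y : ZpExtension.pairKer κ₁ κ₂) (hm : τ⁻¹ * (y : absoluteGaloisGroup K) * τ ∈ pairLayerSubgroup κ₁ κ₂ n) :
    (contOneCocycles.pullback (subgroupConj (ZpExtension.pairKer κ₁ κ₂) τ)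
        (resHomOfEquivariant (subgroupConj (ZpExtension.pairKer κ₁ κ₂) τ) (DistribSMul.toAddMonoidHom _ τ) hc)
        (contOneCocycles.pullback (subgroupInclusion (pairKer_le_pairLayerSubgroup κ₁ κ₂ n))
          (resHomOfEquivariant (subgroupInclusion (pairKer_le_pairLayerSubgroup κ₁ κ₂ n)) (AddMonoidHom.id _) (fun _ _ ↦ rfl)) c)).1 y =
      τ • c.1 ⟨τ⁻¹ * (y : absoluteGaloisGroup K) * τ, hm⟩ := by
  rw [contOneCocycles.pullback_apply, contOneCocycles.pullback_apply]
  change τ • c.1 (subgroupInclusion (pairKer_le_pairLayerSubgroup κ₁ κ₂ n) (subgroupConj (ZpExtension.pairKer κ₁ κ₂) τ y)) = _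
  rfl

/-- **STRICT ⟹ coboundary on `H ⊓ D_v`**: if `c` is a cocycle of `V_n` with `res^{V_n}_H [c] = s` and `conj_τ s` satisfies Greenberg's STRICT
condition at `v` (datum `M⁺_v = 0`), then `τ • c(τ⁻¹ x τ) = x a − a` for some `a ∈ M` and all `x ∈ H ⊓ D_v`.
[cite: Greenberg1989, §1 p. 98] [cite: JohnsonLeungKings2011, §5.4 Lemma 5.8 (arXiv p0015:L150–165)] -/
theorem exists_coboundary_of_mem_strictKer (n : ℕ)
    (c : contOneCocycles (discreteTopRep (↥(pairLayerSubgroup κ₁ κ₂ n)) (charModule (∅ : Set (PadicAlgCl p)) θ)))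
    (s : subgroupH1 (ZpExtension.pairKer κ₁ κ₂) (charModule (∅ : Set (PadicAlgCl p)) θ))
    (hcs : resOfLe _ (pairKer_le_pairLayerSubgroup κ₁ κ₂ n) (oneCocycleClass _ c) = s)
    (v : HeightOneSpectrum (𝓞 K)) (τ : absoluteGaloisGroup K)
    (hst : conjH1 (ZpExtension.pairKer κ₁ κ₂) _ τ s ∈
      (Castella2018.AcSelmer.strictDatum (charModule (∅ : Set (PadicAlgCl p)) θ) v).strictKer (ZpExtension.pairKer κ₁ κ₂)) :
    ∃ a : charModule (∅ : Set (PadicAlgCl p)) θ, ∀ (x : absoluteGaloisGroup K), x ∈ ZpExtension.pairKer κ₁ κ₂ → x ∈ decomp (K := K) v →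
      ∀ hm : τ⁻¹ * x * τ ∈ pairLayerSubgroup κ₁ κ₂ n, τ • c.1 ⟨τ⁻¹ * x * τ, hm⟩ = x • a - a := by
  have hcj : ∀ (x : ↥(ZpExtension.pairKer κ₁ κ₂)) (m : charModule (∅ : Set (PadicAlgCl p)) θ),
      DistribSMul.toAddMonoidHom _ τ (subgroupConj (ZpExtension.pairKer κ₁ κ₂) τ x • m) = x • DistribSMul.toAddMonoidHom _ τ m :=
    fun x m => by
      simp only [DistribSMul.toAddMonoidHom_apply, Subgroup.smul_def, subgroupConj_apply_coe, smul_smul, mul_assoc, mul_inv_cancel_left]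
  -- `s = [f]` for the restricted cocycle `f`, and `conj_τ [f] = [conj f]`
  set f := contOneCocycles.pullback (subgroupInclusion (pairKer_le_pairLayerSubgroup κ₁ κ₂ n))
      (resHomOfEquivariant (subgroupInclusion (pairKer_le_pairLayerSubgroup κ₁ κ₂ n)) (AddMonoidHom.id _) (fun _ _ ↦ rfl)) c with hf
  have hfs : oneCocycleClass _ f = s := by
    rw [← hcs]
    exact (map_oneCocycleClass _ _ _ c).symm
  have hconj : conjH1 (ZpExtension.pairKer κ₁ κ₂) _ τ (oneCocycleClass _ f) = oneCocycleClass _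
      (contOneCocycles.pullback (subgroupConj (ZpExtension.pairKer κ₁ κ₂) τ)
        (resHomOfEquivariant (subgroupConj (ZpExtension.pairKer κ₁ κ₂) τ) (DistribSMul.toAddMonoidHom _ τ) hcj) f) :=
    map_oneCocycleClass _ _ _ f
  rw [← hfs, hconj, LocalDatum.mem_strictKer_iff] at hst
  have h0 : ContinuousCohomology.map (decompInToH (ZpExtension.pairKer κ₁ κ₂) v)
      (resHomOfEquivariant (decompInToH (ZpExtension.pairKer κ₁ κ₂) v)
        (Castella2018.AcSelmer.strictDatum (charModule (∅ : Set (PadicAlgCl p)) θ) v).grMk (fun _ _ ↦ rfl)) 1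
      (oneCocycleClass _ (contOneCocycles.pullback (subgroupConj (ZpExtension.pairKer κ₁ κ₂) τ)
        (resHomOfEquivariant (subgroupConj (ZpExtension.pairKer κ₁ κ₂) τ) (DistribSMul.toAddMonoidHom _ τ) hcj) f)) = 0 :=
    hst
  rw [map_oneCocycleClass, oneCocycleClass_eq_zero_iff] at h0
  obtain ⟨b, hb⟩ := h0
  obtain ⟨a, rfl⟩ := (Castella2018.AcSelmer.strictDatum (charModule (∅ : Set (PadicAlgCl p)) θ) v).grMk_surjective b
  refine ⟨a, fun x hxH hxD hm => ?_⟩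
  let y : decompIn (ZpExtension.pairKer κ₁ κ₂) v := ⟨⟨x, hxD⟩, (mem_decompIn_iff _ v _).mpr hxH⟩
  have key := conj_pullback_pairKer_apply p κ₁ κ₂ θ n c τ hcj (decompInToH (ZpExtension.pairKer κ₁ κ₂) v y) hm
  rw [← hf] at key
  have hy := hb y
  rw [contOneCocycles.pullback_apply] at hy
  change (Castella2018.AcSelmer.strictDatum (charModule (∅ : Set (PadicAlgCl p)) θ) v).grMk
      ((contOneCocycles.pullback (subgroupConj (ZpExtension.pairKer κ₁ κ₂) τ)
        (resHomOfEquivariant (subgroupConj (ZpExtension.pairKer κ₁ κ₂) τ) (DistribSMul.toAddMonoidHom _ τ) hcj) f).1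
        (decompInToH (ZpExtension.pairKer κ₁ κ₂) v y)) = _ at hy
  rw [key] at hy
  -- `hy : grMk (τ • c …) = y • grMk a - grMk a`; the datum is `M⁺ = 0`, so `grMk` is injective
  have hy' : (Castella2018.AcSelmer.strictDatum (charModule (∅ : Set (PadicAlgCl p)) θ) v).grMk (τ • c.1 ⟨τ⁻¹ * x * τ, hm⟩) =
      (Castella2018.AcSelmer.strictDatum (charModule (∅ : Set (PadicAlgCl p)) θ) v).grMk (x • a - a) := by
    rw [map_sub]
    exact hy
  obtain ⟨w, hw, hww⟩ := (QuotientAddGroup.mk'_eq_mk' _).mp hy'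
  have hw0 : w = 0 := hw
  rw [hw0, add_zero] at hww
  exact hww

/-- **UNRAMIFIED ⟹ coboundary on `H ⊓ I_v`**: the same with the unramified condition of `conj_τ s` at `v` and `x ∈ H ⊓ I_v`.
[cite: GreenbergVatsal2000, §2 p. 17] [cite: JohnsonLeungKings2011, §5.4 Lemma 5.8 (arXiv p0015:L150–165)] -/
theorem exists_coboundary_of_mem_unramifiedKer (n : ℕ)
    (c : contOneCocycles (discreteTopRep (↥(pairLayerSubgroup κ₁ κ₂ n)) (charModule (∅ : Set (PadicAlgCl p)) θ)))
    (s : subgroupH1 (ZpExtension.pairKer κ₁ κ₂) (charModule (∅ : Set (PadicAlgCl p)) θ))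
    (hcs : resOfLe _ (pairKer_le_pairLayerSubgroup κ₁ κ₂ n) (oneCocycleClass _ c) = s)
    (v : HeightOneSpectrum (𝓞 K)) (τ : absoluteGaloisGroup K)
    (hu : conjH1 (ZpExtension.pairKer κ₁ κ₂) _ τ s ∈ unramifiedKer (ZpExtension.pairKer κ₁ κ₂) (charModule (∅ : Set (PadicAlgCl p)) θ) v) :
    ∃ a : charModule (∅ : Set (PadicAlgCl p)) θ, ∀ (x : absoluteGaloisGroup K), x ∈ ZpExtension.pairKer κ₁ κ₂ →
      x ∈ GreenbergSelmer.inertia (K := K) v →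
      ∀ hm : τ⁻¹ * x * τ ∈ pairLayerSubgroup κ₁ κ₂ n, τ • c.1 ⟨τ⁻¹ * x * τ, hm⟩ = x • a - a := by
  have hcj : ∀ (x : ↥(ZpExtension.pairKer κ₁ κ₂)) (m : charModule (∅ : Set (PadicAlgCl p)) θ),
      DistribSMul.toAddMonoidHom _ τ (subgroupConj (ZpExtension.pairKer κ₁ κ₂) τ x • m) = x • DistribSMul.toAddMonoidHom _ τ m :=
    fun x m => by
      simp only [DistribSMul.toAddMonoidHom_apply, Subgroup.smul_def, subgroupConj_apply_coe, smul_smul, mul_assoc, mul_inv_cancel_left]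
  set f := contOneCocycles.pullback (subgroupInclusion (pairKer_le_pairLayerSubgroup κ₁ κ₂ n))
      (resHomOfEquivariant (subgroupInclusion (pairKer_le_pairLayerSubgroup κ₁ κ₂ n)) (AddMonoidHom.id _) (fun _ _ ↦ rfl)) c with hf
  have hfs : oneCocycleClass _ f = s := by
    rw [← hcs]
    exact (map_oneCocycleClass _ _ _ c).symm
  have hconj : conjH1 (ZpExtension.pairKer κ₁ κ₂) _ τ (oneCocycleClass _ f) = oneCocycleClass _
      (contOneCocycles.pullback (subgroupConj (ZpExtension.pairKer κ₁ κ₂) τ)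
        (resHomOfEquivariant (subgroupConj (ZpExtension.pairKer κ₁ κ₂) τ) (DistribSMul.toAddMonoidHom _ τ) hcj) f) :=
    map_oneCocycleClass _ _ _ f
  have hu' := hu
  rw [← hfs, hconj, oneCocycleClass_mem_unramifiedKer_iff] at hu'
  obtain ⟨a, ha⟩ := hu'
  refine ⟨a, fun x hxH hxI hm => ?_⟩
  let y : inertiaIn (ZpExtension.pairKer κ₁ κ₂) v :=
    ⟨⟨x, inertia_le_decomp v hxI⟩, (mem_inertiaIn_iff _ v _).mpr ⟨hxH, hxI⟩⟩
  have key := conj_pullback_pairKer_apply p κ₁ κ₂ θ n c τ hcj (inertiaInToH (ZpExtension.pairKer κ₁ κ₂) v y) hm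
  rw [← hf] at key
  exact key.symm.trans (ha y)

/-! ## §2 Transfer to the layer coefficients `(ℤ/p^k)(θ)` -/

omit [NumberField K] in
/-- **Transfer of the coboundary identity to the descended cocycle.**  If `z` is a layer cocycle with `e (z(π w)) = c(w)` on `V_n`
(`e = zmodToCharModule θ k`), `e a′ = a` and `τ • c(τ⁻¹xτ) = x a − a`, then `πτ · z(π(τ⁻¹xτ)) = x a′ − a′` in `(ℤ/p^k)(θ)` (injectivity
and equivariance of `e`). [cite: JohnsonLeungKings2011, §1.2 Def. 1.1, §5.4 Lemma 5.8] -/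
theorem layer_coboundary_of_coboundary (n k : ℕ)
    (c : contOneCocycles (discreteTopRep (↥(pairLayerSubgroup κ₁ κ₂ n)) (charModule (∅ : Set (PadicAlgCl p)) θ)))
    (z : contOneCocycles (subgroupRep (((zmodTwist p (unitChar θ) k).quotientInvariants
        (ramificationSubgroup K (suppPF p 𝔣))).toTopRep) ((pairLayerSubgroup κ₁ κ₂ n).map (toUnramifiedQuot K (suppPF p 𝔣)))))
    (hz : ∀ w : pairLayerSubgroup κ₁ κ₂ n, zmodToCharModule θ k ((z.1 ⟨toUnramifiedQuot K (suppPF p 𝔣) w, Subgroup.mem_map_of_mem _ w.2⟩ :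
        Representation.invariants ((zmodTwist p (unitChar θ) k).toRepresentation.comp (ramificationSubgroup K (suppPF p 𝔣)).subtype)) :
          ZMod (p ^ k)) = c.1 w)
    {τ x : absoluteGaloisGroup K} (hm : τ⁻¹ * x * τ ∈ pairLayerSubgroup κ₁ κ₂ n)
    {a : charModule (∅ : Set (PadicAlgCl p)) θ} {a' : ZMod (p ^ k)} (ha : zmodToCharModule θ k a' = a)
    (hx : τ • c.1 ⟨τ⁻¹ * x * τ, hm⟩ = x • a - a)
    (hm' : toUnramifiedQuot K (suppPF p 𝔣) (τ⁻¹ * x * τ) ∈ (pairLayerSubgroup κ₁ κ₂ n).map (toUnramifiedQuot K (suppPF p 𝔣)))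
    (b : Representation.invariants ((zmodTwist p (unitChar θ) k).toRepresentation.comp (ramificationSubgroup K (suppPF p 𝔣)).subtype))
    (hb : (b : ZMod (p ^ k)) = a') :
    ((((zmodTwist p (unitChar θ) k).quotientInvariants (ramificationSubgroup K (suppPF p 𝔣))).toTopRep.ρ
        (toUnramifiedQuot K (suppPF p 𝔣) τ) (z.1 ⟨_, hm'⟩) :
        Representation.invariants ((zmodTwist p (unitChar θ) k).toRepresentation.comp (ramificationSubgroup K (suppPF p 𝔣)).subtype)) :
          ZMod (p ^ k)) = zmodTwist p (unitChar θ) k x (b : ZMod (p ^ k)) - b := by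
  apply zmodToCharModule_injective θ k
  have hzz : z.1 ⟨_, hm'⟩ = z.1 ⟨toUnramifiedQuot K (suppPF p 𝔣) ((⟨τ⁻¹ * x * τ, hm⟩ : pairLayerSubgroup κ₁ κ₂ n) : absoluteGaloisGroup K),
      Subgroup.mem_map_of_mem _ hm⟩ := rfl
  change zmodToCharModule θ k (zmodTwist p (unitChar θ) k τ ((z.1 ⟨_, hm'⟩ : Representation.invariants _) : ZMod (p ^ k))) = _
  rw [zmodToCharModule_equivariant, hzz, hz ⟨τ⁻¹ * x * τ, hm⟩, hx, hb, map_sub, zmodToCharModule_equivariant, ha]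

/-! ## §3 The local vanishing / `2`-torsion of the layer classes at `Gal(K̄_v/K̃_{∞,w})` -/

omit [NumberField K] in
/-- An inertia element on which `unitChar θ = −1` acts as `−1` on `(ℤ/p^k)(θ)`. [cite: JohnsonLeungKings2011, §1.2 Def. 1.1] -/
theorem zmodTwist_apply_of_apply_eq_neg_one (k : ℕ) {σ : absoluteGaloisGroup K} (hσ : unitChar θ σ = -1) (m : ZMod (p ^ k)) :
    zmodTwist p (unitChar θ) k σ m = -m := by
  rw [zmodTwist_apply, charModPow_apply, hσ, Units.val_neg, Units.val_one, map_neg, map_one, neg_one_mul]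

/-- **Strict case: the localisation of `conj_{πτ}[z]` dies on `Λ_H = res_v⁻¹(Gal(K̄/K̃_∞))`** (given the coboundary `a = e a′` on
`H ⊓ D_v`). [cite: MilneADT2006, I §4 (p. 56)] [cite: JohnsonLeungKings2011, §5.4 Lemma 5.8] -/
theorem resLe_loc_conj_eq_zero_of_coboundary (n k : ℕ)
    (c : contOneCocycles (discreteTopRep (↥(pairLayerSubgroup κ₁ κ₂ n)) (charModule (∅ : Set (PadicAlgCl p)) θ)))
    (z : contOneCocycles (subgroupRep (((zmodTwist p (unitChar θ) k).quotientInvariants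
        (ramificationSubgroup K (suppPF p 𝔣))).toTopRep) ((pairLayerSubgroup κ₁ κ₂ n).map (toUnramifiedQuot K (suppPF p 𝔣)))))
    (hz : ∀ w : pairLayerSubgroup κ₁ κ₂ n, zmodToCharModule θ k ((z.1 ⟨toUnramifiedQuot K (suppPF p 𝔣) w, Subgroup.mem_map_of_mem _ w.2⟩ :
        Representation.invariants ((zmodTwist p (unitChar θ) k).toRepresentation.comp (ramificationSubgroup K (suppPF p 𝔣)).subtype)) :
          ZMod (p ^ k)) = c.1 w)
    (v : HeightOneSpectrum (𝓞 K)) (τ : absoluteGaloisGroup K) {a : charModule (∅ : Set (PadicAlgCl p)) θ} {a' : ZMod (p ^ k)}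
    (ha : zmodToCharModule θ k a' = a)
    (hx : ∀ (x : absoluteGaloisGroup K), x ∈ ZpExtension.pairKer κ₁ κ₂ → x ∈ decomp (K := K) v →
      ∀ hm : τ⁻¹ * x * τ ∈ pairLayerSubgroup κ₁ κ₂ n, τ • c.1 ⟨τ⁻¹ * x * τ, hm⟩ = x • a - a)
    (hZ : ramificationSubgroup K (suppPF p 𝔣) ≤ ContinuousRep.ker (zmodTwist p (unitChar θ) k)) :
    (resLe (TopRep.res (locHom (S := suppPF p 𝔣) v : absoluteGaloisGroup (v.adicCompletion K) →* GaloisGroupUnramifiedOutside K (suppPF p 𝔣))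
          ((zmodTwist p (unitChar θ) k).quotientInvariants (ramificationSubgroup K (suppPF p 𝔣))).toTopRep)
        (comap_absGaloisRestrict_le_comap_locHom (suppPF p 𝔣) (pairKer_le_pairLayerSubgroup κ₁ κ₂ n) v) 1).hom
      (layerLocalization (suppPF p 𝔣) (zmodTwist p (unitChar θ) k) (pairLayerSubgroup κ₁ κ₂ n) (Sum.inr v) 1
        (ShaLayer.layerConj (suppPF p 𝔣) (zmodTwist p (unitChar θ) k) (pairLayerSubgroup κ₁ κ₂ n) (toUnramifiedQuot K (suppPF p 𝔣) τ) 1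
          (oneCocycleClass _ z))) = 0 := by
  have hmem : a' ∈ Representation.invariants ((zmodTwist p (unitChar θ) k).toRepresentation.comp (ramificationSubgroup K (suppPF p 𝔣)).subtype) :=
    (Representation.mem_invariants _ _).mpr fun g => by
      have h := (ContinuousRep.mem_ker _ _).mp (hZ g.2)
      change zmodTwist p (unitChar θ) k (g : absoluteGaloisGroup K) a' = a'
      rw [h]
      rfl
  refine resLe_layerLocalization_layerConj_eq_zero (suppPF p 𝔣) (zmodTwist p (unitChar θ) k) (pairKer_le_pairLayerSubgroup κ₁ κ₂ n) v τ z
    ⟨a', hmem⟩ fun x hxH hxD hm' => ?_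
  have hm : τ⁻¹ * x * τ ∈ pairLayerSubgroup κ₁ κ₂ n :=
    pairKer_le_pairLayerSubgroup κ₁ κ₂ n ((inferInstance : (ZpExtension.pairKer κ₁ κ₂).Normal).conj_mem' x hxH τ)
  exact layer_coboundary_of_coboundary p κ₁ κ₂ θ 𝔣 n k c z hz hm ha (hx x hxH hxD hm) hm' ⟨a', hmem⟩ rfl

/-- **Unramified case (θ quadratically ramified at `v`): `2 •` the localisation of `conj_{πτ}[z]` dies on `Λ_H`** (given the coboundary
`a = e a′` on `H ⊓ I_v` and an inertia element `i₀` of `K_v` with `res i₀ ∈ H` and `unitChar θ (res i₀) = −1`).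
[cite: MilneADT2006, I §4 (p. 56)] [cite: JohnsonLeungKings2011, §5.4 Lemma 5.8] -/
theorem two_nsmul_resLe_loc_conj_eq_zero_of_coboundary (n k : ℕ)
    (c : contOneCocycles (discreteTopRep (↥(pairLayerSubgroup κ₁ κ₂ n)) (charModule (∅ : Set (PadicAlgCl p)) θ)))
    (z : contOneCocycles (subgroupRep (((zmodTwist p (unitChar θ) k).quotientInvariants
        (ramificationSubgroup K (suppPF p 𝔣))).toTopRep) ((pairLayerSubgroup κ₁ κ₂ n).map (toUnramifiedQuot K (suppPF p 𝔣)))))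
    (hz : ∀ w : pairLayerSubgroup κ₁ κ₂ n, zmodToCharModule θ k ((z.1 ⟨toUnramifiedQuot K (suppPF p 𝔣) w, Subgroup.mem_map_of_mem _ w.2⟩ :
        Representation.invariants ((zmodTwist p (unitChar θ) k).toRepresentation.comp (ramificationSubgroup K (suppPF p 𝔣)).subtype)) :
          ZMod (p ^ k)) = c.1 w)
    (v : HeightOneSpectrum (𝓞 K)) (τ : absoluteGaloisGroup K) {a : charModule (∅ : Set (PadicAlgCl p)) θ} {a' : ZMod (p ^ k)}
    (ha : zmodToCharModule θ k a' = a)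
    (hx : ∀ (x : absoluteGaloisGroup K), x ∈ ZpExtension.pairKer κ₁ κ₂ → x ∈ GreenbergSelmer.inertia (K := K) v →
      ∀ hm : τ⁻¹ * x * τ ∈ pairLayerSubgroup κ₁ κ₂ n, τ • c.1 ⟨τ⁻¹ * x * τ, hm⟩ = x • a - a)
    (hZ : ramificationSubgroup K (suppPF p 𝔣) ≤ ContinuousRep.ker (zmodTwist p (unitChar θ) k))
    (i₀ : absoluteGaloisGroup (v.adicCompletion K)) (hi₀ : i₀ ∈ absInertia (v.adicCompletion K))
    (hi₀H : absGaloisRestrict K (v.adicCompletion K) i₀ ∈ ZpExtension.pairKer κ₁ κ₂)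
    (hθi₀ : unitChar θ (absGaloisRestrict K (v.adicCompletion K) i₀) = -1) :
    2 • (resLe (TopRep.res (locHom (S := suppPF p 𝔣) v : absoluteGaloisGroup (v.adicCompletion K) →*
            GaloisGroupUnramifiedOutside K (suppPF p 𝔣))
          ((zmodTwist p (unitChar θ) k).quotientInvariants (ramificationSubgroup K (suppPF p 𝔣))).toTopRep)
        (comap_absGaloisRestrict_le_comap_locHom (suppPF p 𝔣) (pairKer_le_pairLayerSubgroup κ₁ κ₂ n) v) 1).hom
      (layerLocalization (suppPF p 𝔣) (zmodTwist p (unitChar θ) k) (pairLayerSubgroup κ₁ κ₂ n) (Sum.inr v) 1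
        (ShaLayer.layerConj (suppPF p 𝔣) (zmodTwist p (unitChar θ) k) (pairLayerSubgroup κ₁ κ₂ n) (toUnramifiedQuot K (suppPF p 𝔣) τ) 1
          (oneCocycleClass _ z))) = 0 := by
  have hmem : a' ∈ Representation.invariants ((zmodTwist p (unitChar θ) k).toRepresentation.comp (ramificationSubgroup K (suppPF p 𝔣)).subtype) :=
    (Representation.mem_invariants _ _).mpr fun g => by
      have h := (ContinuousRep.mem_ker _ _).mp (hZ g.2)
      change zmodTwist p (unitChar θ) k (g : absoluteGaloisGroup K) a' = a'
      rw [h]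
      rfl
  refine two_nsmul_resLe_layerLocalization_layerConj_eq_zero (suppPF p 𝔣) (zmodTwist p (unitChar θ) k)
    (pairKer_le_pairLayerSubgroup κ₁ κ₂ n) v τ z ⟨a', hmem⟩ (fun x hxH hxI hm' => ?_) i₀ hi₀ hi₀H
    (fun m => zmodTwist_apply_of_apply_eq_neg_one p θ k hθi₀ m)
  have hm : τ⁻¹ * x * τ ∈ pairLayerSubgroup κ₁ κ₂ n :=
    pairKer_le_pairLayerSubgroup κ₁ κ₂ n ((inferInstance : (ZpExtension.pairKer κ₁ κ₂).Normal).conj_mem' x hxH τ)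
  exact layer_coboundary_of_coboundary p κ₁ κ₂ θ 𝔣 n k c z hz hm ha (hx x hxH hxI hm) hm' ⟨a', hmem⟩ rfl

end Literature.NumberTheory.ComplexMultiplication.EllipticUnits.JohnsonLeungKings2011.ClassGroupRow

end
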